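import Summits.CriticalPhenomena.PercolationContinuityZ3.Theorems.PercNearOneGluingNoHeavyLowerTailSahiOneStepTwoLumpReducePrelim
import Summits.CriticalPhenomena.PercolationContinuityZ3.Theorems.PercNearOneGluingNoHeavyLowerTailSahiOneStepRegionReduce
import Summits.CriticalPhenomena.PercolationContinuityZ3.Theorems.PercNearOneGluingNoHeavyQuantLevelTrials
import HarnessLib

/-!
# Two-sided lumping with a free block — part 2: the hull and the removal over the two-sided costly region do not increase `Ψ`

Support file (prover prim-ineq-prove-3 gen 53; `--supports stmt-CriticalPhenomena-4575`; memo
`run/shared/lean/prim/prim-ineq-prove-3/PROOF-G53-TL-FREE-BLOCK.md` §1, §3).  No definitions, no named facts, no sorries, no `native_decide`.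

Setting: `μ = prodBernoulli p` (ANY density vector), blocks `K ⊆ S`, `R = S ∖ K`, levels `t, s`, `T = Th_t(S)`, `V = Th_s(S)`, and gen 50's
TWO-SIDED LUMPING FUNCTIONAL (written out, as in `…TwoLumpStep`)
`Ψ(A,B) = (1−μT)μV(μ(T∩A∩B) − μ(V∩A∩B)) + μV(μA − μ(T∩A))(μB − μ(T∩B)) + (1−μT)μ(V∩A)μ(V∩B) − (1−μT)μV·μA·μB`.
Part 1 (`…TwoLumpReducePrelim`) provides the variation formula `Ψ(A, X ⊔ D) = Ψ(A,X) + VAR(A,D)` and the level sums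
`VAR(A,D) = Σ_k μ(D ∩ {#K = k})·Cout(k)` (`D` disjoint from `A`) / `·Cin(k)` (`D ⊆ A`).  Here (§4): the two-sided COSTLY REGION
`G = (A ∩ {g₁ ≤ #(K∩ω)}) ∪ {g₂ ≤ #(K∩ω)}`, the hull `B♯ = {ω | every ω' ⊇ ω in G lies in B}` and the removal `B₂ = ↑(B♯ ∖ G)`, and
**`twoLump_sharp_le`**, **`twoLump_lift_le`**: `Ψ(A,B♯) ≤ Ψ(A,B)` under the FREE-level signs (`Cout(k) ≤ 0` for `k < g₂`, `Cin(k) ≤ 0` for `k < g₁`)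
and `Ψ(A,B₂) ≤ Ψ(A,B♯)` under the COSTLY-level signs (`0 ≤ Cout(k)` for `k ≥ g₂`, `0 ≤ Cin(k)` for `k ≥ g₁`, `g₁ ≤ g₂`) — the sign pattern that
`…TwoLumpLevels` (LEMMA U) provides.
-/

noncomputable section

namespace Summit.CriticalPhenomena.PercolationContinuityZ3.Theorems

namespace SahiOneStep

open MeasureTheory Finset
open Literature.Probability.Percolation (DeterminedBy determinedBy_iff)
open Literature.Probability.LatticeModels (prodBernoulli prodBernoulli_real_inter_of_determinedBy_disjoint)
open Literature.Probability.Percolation.DecisionTree (ind)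
open scoped Classical

variable {ι : Type*} [Fintype ι]

/-! ## §4 The costly region, the hull and the removal for `Ψ` -/

section reduct

variable {K S : Finset ι} {g₁ g₂ : ℕ} {A B : Set (Set ι)}

omit [Fintype ι] in
/-- The two-sided costly region `G = (A ∩ {g₁ ≤ #(K∩ω)}) ∪ {g₂ ≤ #(K∩ω)}` is increasing. [this work] -/
theorem isUpperSet_costly2 (hA : IsUpperSet A) (K : Finset ι) (g₁ g₂ : ℕ) :
    IsUpperSet ((A ∩ {ω : Set ι | g₁ ≤ (K.filter (· ∈ ω)).card}) ∪ {ω : Set ι | g₂ ≤ (K.filter (· ∈ ω)).card}) :=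
  (isUpperSet_costly hA K g₁).union (isUpperSet_threshold K g₂)

omit [Fintype ι] in
/-- It is `K`-determined. [this work] -/
theorem determinedBy_costly2 (hAK : DeterminedBy A (↑K : Set ι)) (g₁ g₂ : ℕ) :
    DeterminedBy ((A ∩ {ω : Set ι | g₁ ≤ (K.filter (· ∈ ω)).card}) ∪ {ω : Set ι | g₂ ≤ (K.filter (· ∈ ω)).card}) (↑K : Set ι) :=
  Quant.determinedBy_union_of (determinedBy_costly hAK g₁) (determinedBy_threshold K g₂)

/-- **The hull step does not increase `Ψ`** (slot `S ⊇ K`, any density): with `G = (A ∩ Th_{g₁}K) ∪ Th_{g₂}K`, `g₁ ≤ g₂`, and the FREE-level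
signs `Cout(k) ≤ 0` for `k < g₂`, `Cin(k) ≤ 0` for `k < g₁`: `Ψ(A, B♯) ≤ Ψ(A, B)`, `B♯ = {ω | every ω' ⊇ ω in G lies in B}`. [this work] -/
theorem twoLump_sharp_le (p : ι → unitInterval) (hKS : K ⊆ S) (t s : ℕ) (hB : IsUpperSet B)
    (hAK : DeterminedBy A (↑K : Set ι)) (hBK : DeterminedBy B (↑K : Set ι))
    (hout : ∀ k, k < g₂ → ((prodBernoulli p).real {ω : Set ι | s ≤ (S.filter (· ∈ ω)).card} *
            ((prodBernoulli p).real A - (prodBernoulli p).real ({ω : Set ι | t ≤ (S.filter (· ∈ ω)).card} ∩ A)) *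
            (1 - (prodBernoulli p).real {ω : Set ι | t ≤ ((S \ K).filter (· ∈ ω)).card + k})
          + (1 - (prodBernoulli p).real {ω : Set ι | t ≤ (S.filter (· ∈ ω)).card}) *
            (prodBernoulli p).real ({ω : Set ι | s ≤ (S.filter (· ∈ ω)).card} ∩ A) *
            (prodBernoulli p).real {ω : Set ι | s ≤ ((S \ K).filter (· ∈ ω)).card + k}
          - (1 - (prodBernoulli p).real {ω : Set ι | t ≤ (S.filter (· ∈ ω)).card}) * (prodBernoulli p).real {ω : Set ι | s ≤ (S.filter (· ∈ ω)).card} *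
            (prodBernoulli p).real A) ≤ 0)
    (hin : ∀ k, k < g₁ → ((1 - (prodBernoulli p).real {ω : Set ι | t ≤ (S.filter (· ∈ ω)).card}) * (prodBernoulli p).real {ω : Set ι | s ≤ (S.filter (· ∈ ω)).card} *
            ((prodBernoulli p).real {ω : Set ι | t ≤ ((S \ K).filter (· ∈ ω)).card + k}
              - (prodBernoulli p).real {ω : Set ι | s ≤ ((S \ K).filter (· ∈ ω)).card + k})
          + ((prodBernoulli p).real {ω : Set ι | s ≤ (S.filter (· ∈ ω)).card} *
              ((prodBernoulli p).real A - (prodBernoulli p).real ({ω : Set ι | t ≤ (S.filter (· ∈ ω)).card} ∩ A)) *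
              (1 - (prodBernoulli p).real {ω : Set ι | t ≤ ((S \ K).filter (· ∈ ω)).card + k})
            + (1 - (prodBernoulli p).real {ω : Set ι | t ≤ (S.filter (· ∈ ω)).card}) *
              (prodBernoulli p).real ({ω : Set ι | s ≤ (S.filter (· ∈ ω)).card} ∩ A) *
              (prodBernoulli p).real {ω : Set ι | s ≤ ((S \ K).filter (· ∈ ω)).card + k}
            - (1 - (prodBernoulli p).real {ω : Set ι | t ≤ (S.filter (· ∈ ω)).card}) *
              (prodBernoulli p).real {ω : Set ι | s ≤ (S.filter (· ∈ ω)).card} * (prodBernoulli p).real A)) ≤ 0) :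
    ((1 - (prodBernoulli p).real {ω : Set ι | t ≤ (S.filter (· ∈ ω)).card}) * (prodBernoulli p).real {ω : Set ι | s ≤ (S.filter (· ∈ ω)).card} *
          ((prodBernoulli p).real ({ω : Set ι | t ≤ (S.filter (· ∈ ω)).card} ∩ A ∩ {ω : Set ι | ∀ ω' : Set ι, ω ⊆ ω' → ω' ∈ (A ∩ {ω : Set ι | g₁ ≤ (K.filter (· ∈ ω)).card}) ∪ {ω : Set ι | g₂ ≤ (K.filter (· ∈ ω)).card} → ω' ∈ B})
            - (prodBernoulli p).real ({ω : Set ι | s ≤ (S.filter (· ∈ ω)).card} ∩ A ∩ {ω : Set ι | ∀ ω' : Set ι, ω ⊆ ω' → ω' ∈ (A ∩ {ω : Set ι | g₁ ≤ (K.filter (· ∈ ω)).card}) ∪ {ω : Set ι | g₂ ≤ (K.filter (· ∈ ω)).card} → ω' ∈ B}))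
        + (prodBernoulli p).real {ω : Set ι | s ≤ (S.filter (· ∈ ω)).card} *
          ((prodBernoulli p).real A - (prodBernoulli p).real ({ω : Set ι | t ≤ (S.filter (· ∈ ω)).card} ∩ A)) *
          ((prodBernoulli p).real {ω : Set ι | ∀ ω' : Set ι, ω ⊆ ω' → ω' ∈ (A ∩ {ω : Set ι | g₁ ≤ (K.filter (· ∈ ω)).card}) ∪ {ω : Set ι | g₂ ≤ (K.filter (· ∈ ω)).card} → ω' ∈ B} - (prodBernoulli p).real ({ω : Set ι | t ≤ (S.filter (· ∈ ω)).card} ∩ {ω : Set ι | ∀ ω' : Set ι, ω ⊆ ω' → ω' ∈ (A ∩ {ω : Set ι | g₁ ≤ (K.filter (· ∈ ω)).card}) ∪ {ω : Set ι | g₂ ≤ (K.filter (· ∈ ω)).card} → ω' ∈ B}))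
        + (1 - (prodBernoulli p).real {ω : Set ι | t ≤ (S.filter (· ∈ ω)).card}) *
          (prodBernoulli p).real ({ω : Set ι | s ≤ (S.filter (· ∈ ω)).card} ∩ A) *
          (prodBernoulli p).real ({ω : Set ι | s ≤ (S.filter (· ∈ ω)).card} ∩ {ω : Set ι | ∀ ω' : Set ι, ω ⊆ ω' → ω' ∈ (A ∩ {ω : Set ι | g₁ ≤ (K.filter (· ∈ ω)).card}) ∪ {ω : Set ι | g₂ ≤ (K.filter (· ∈ ω)).card} → ω' ∈ B})
        - (1 - (prodBernoulli p).real {ω : Set ι | t ≤ (S.filter (· ∈ ω)).card}) * (prodBernoulli p).real {ω : Set ι | s ≤ (S.filter (· ∈ ω)).card} *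
          (prodBernoulli p).real A * (prodBernoulli p).real {ω : Set ι | ∀ ω' : Set ι, ω ⊆ ω' → ω' ∈ (A ∩ {ω : Set ι | g₁ ≤ (K.filter (· ∈ ω)).card}) ∪ {ω : Set ι | g₂ ≤ (K.filter (· ∈ ω)).card} → ω' ∈ B})
      ≤ ((1 - (prodBernoulli p).real {ω : Set ι | t ≤ (S.filter (· ∈ ω)).card}) * (prodBernoulli p).real {ω : Set ι | s ≤ (S.filter (· ∈ ω)).card} *
          ((prodBernoulli p).real ({ω : Set ι | t ≤ (S.filter (· ∈ ω)).card} ∩ A ∩ B)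
            - (prodBernoulli p).real ({ω : Set ι | s ≤ (S.filter (· ∈ ω)).card} ∩ A ∩ B))
        + (prodBernoulli p).real {ω : Set ι | s ≤ (S.filter (· ∈ ω)).card} *
          ((prodBernoulli p).real A - (prodBernoulli p).real ({ω : Set ι | t ≤ (S.filter (· ∈ ω)).card} ∩ A)) *
          ((prodBernoulli p).real B - (prodBernoulli p).real ({ω : Set ι | t ≤ (S.filter (· ∈ ω)).card} ∩ B))
        + (1 - (prodBernoulli p).real {ω : Set ι | t ≤ (S.filter (· ∈ ω)).card}) *
          (prodBernoulli p).real ({ω : Set ι | s ≤ (S.filter (· ∈ ω)).card} ∩ A) *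
          (prodBernoulli p).real ({ω : Set ι | s ≤ (S.filter (· ∈ ω)).card} ∩ B)
        - (1 - (prodBernoulli p).real {ω : Set ι | t ≤ (S.filter (· ∈ ω)).card}) * (prodBernoulli p).real {ω : Set ι | s ≤ (S.filter (· ∈ ω)).card} *
          (prodBernoulli p).real A * (prodBernoulli p).real B) := by
  set G : Set (Set ι) := (A ∩ {ω : Set ι | g₁ ≤ (K.filter (· ∈ ω)).card}) ∪ {ω : Set ι | g₂ ≤ (K.filter (· ∈ ω)).card} with hGdef
  set Bs : Set (Set ι) := {ω : Set ι | ∀ ω' : Set ι, ω ⊆ ω' → ω' ∈ G → ω' ∈ B} with hBsdef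
  set D₁ : Set (Set ι) := (Bs \ B) \ A with hD₁
  set D₂ : Set (Set ι) := (Bs \ B) ∩ A with hD₂
  have hBBs : B ⊆ Bs := subset_hgen G hB
  have hdec : Bs = (B ∪ D₁) ∪ D₂ := by
    ext ω
    simp only [hD₁, hD₂, Set.mem_union, Set.mem_sdiff, Set.mem_inter_iff]
    constructor
    · intro h
      by_cases hb : ω ∈ B
      · exact Or.inl (Or.inl hb)
      · by_cases ha : ω ∈ A
        · exact Or.inr ⟨⟨h, hb⟩, ha⟩
        · exact Or.inl (Or.inr ⟨⟨h, hb⟩, ha⟩)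
    · rintro ((hb | ⟨⟨h, _⟩, _⟩) | ⟨⟨h, _⟩, _⟩)
      · exact hBBs hb
      · exact h
      · exact h
  have hdisj1 : Disjoint B D₁ := Set.disjoint_left.2 fun ω hb hd => hd.1.2 hb
  have hdisj2 : Disjoint (B ∪ D₁) D₂ := Set.disjoint_left.2 fun ω h hd => by
    rcases h with hb | hd1
    · exact hd.1.2 hb
    · exact hd1.2 hd.2
  have hD₁A : Disjoint D₁ A := Set.disjoint_left.2 fun ω hd ha => hd.2 ha
  have hD₂A : D₂ ⊆ A := fun ω h => h.2
  have hGK : DeterminedBy G (↑K : Set ι) := determinedBy_costly2 hAK g₁ g₂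
  have hBsK : DeterminedBy Bs (↑K : Set ι) := determinedBy_hgen hGK hBK
  have hD₁K : DeterminedBy D₁ (↑K : Set ι) := determinedBy_sdiff' (determinedBy_sdiff' hBsK hBK) hAK
  have hD₂K : DeterminedBy D₂ (↑K : Set ι) := (determinedBy_sdiff' hBsK hBK).inter hAK
  -- levels: points of `Bs \ B` are outside `G`
  have hlev₁ : ∀ ω ∈ D₁, (K.filter (· ∈ ω)).card < g₂ := by
    intro ω hω
    have hnG : ω ∉ G := hgen_sdiff_subset_compl G B hω.1
    by_contra h
    exact hnG (Or.inr (by simp only [Set.mem_setOf_eq]; omega))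
  have hlev₂ : ∀ ω ∈ D₂, (K.filter (· ∈ ω)).card < g₁ := by
    intro ω hω
    have hnG : ω ∉ G := hgen_sdiff_subset_compl G B hω.1
    by_contra h
    exact hnG (Or.inl ⟨hω.2, by simp only [Set.mem_setOf_eq]; omega⟩)
  rw [hdec, twoLumpVar_union p _ _ A _ _ hdisj2, twoLumpVar_union p _ _ A _ _ hdisj1]
  -- the two variations are ≤ 0
  have hv₁ : ((1 - (prodBernoulli p).real {ω : Set ι | t ≤ (S.filter (· ∈ ω)).card}) * (prodBernoulli p).real {ω : Set ι | s ≤ (S.filter (· ∈ ω)).card} *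
          ((prodBernoulli p).real ({ω : Set ι | t ≤ (S.filter (· ∈ ω)).card} ∩ A ∩ D₁)
            - (prodBernoulli p).real ({ω : Set ι | s ≤ (S.filter (· ∈ ω)).card} ∩ A ∩ D₁))
        + (prodBernoulli p).real {ω : Set ι | s ≤ (S.filter (· ∈ ω)).card} *
          ((prodBernoulli p).real A - (prodBernoulli p).real ({ω : Set ι | t ≤ (S.filter (· ∈ ω)).card} ∩ A)) *
          ((prodBernoulli p).real D₁ - (prodBernoulli p).real ({ω : Set ι | t ≤ (S.filter (· ∈ ω)).card} ∩ D₁))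
        + (1 - (prodBernoulli p).real {ω : Set ι | t ≤ (S.filter (· ∈ ω)).card}) *
          (prodBernoulli p).real ({ω : Set ι | s ≤ (S.filter (· ∈ ω)).card} ∩ A) *
          (prodBernoulli p).real ({ω : Set ι | s ≤ (S.filter (· ∈ ω)).card} ∩ D₁)
        - (1 - (prodBernoulli p).real {ω : Set ι | t ≤ (S.filter (· ∈ ω)).card}) * (prodBernoulli p).real {ω : Set ι | s ≤ (S.filter (· ∈ ω)).card} *
          (prodBernoulli p).real A * (prodBernoulli p).real D₁) ≤ 0 := by
    rw [← inter_ballPart_card_succ K D₁, twoLumpVar_ballPart_eq_sum_out p hKS t s hD₁K hD₁A (K.card + 1)]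
    refine sum_nonpos fun k _ => ?_
    by_cases hk : k < g₂
    · exact mul_nonpos_of_nonneg_of_nonpos measureReal_nonneg (hout k hk)
    · have : D₁ ∩ {ω : Set ι | (K.filter (· ∈ ω)).card = k} = ∅ := Set.eq_empty_of_forall_notMem fun ω h => by
        have := hlev₁ ω h.1; have h2 := h.2; simp only [Set.mem_setOf_eq] at h2; omega
      rw [this, measureReal_empty, zero_mul]
  have hv₂ : ((1 - (prodBernoulli p).real {ω : Set ι | t ≤ (S.filter (· ∈ ω)).card}) * (prodBernoulli p).real {ω : Set ι | s ≤ (S.filter (· ∈ ω)).card} *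
          ((prodBernoulli p).real ({ω : Set ι | t ≤ (S.filter (· ∈ ω)).card} ∩ A ∩ D₂)
            - (prodBernoulli p).real ({ω : Set ι | s ≤ (S.filter (· ∈ ω)).card} ∩ A ∩ D₂))
        + (prodBernoulli p).real {ω : Set ι | s ≤ (S.filter (· ∈ ω)).card} *
          ((prodBernoulli p).real A - (prodBernoulli p).real ({ω : Set ι | t ≤ (S.filter (· ∈ ω)).card} ∩ A)) *
          ((prodBernoulli p).real D₂ - (prodBernoulli p).real ({ω : Set ι | t ≤ (S.filter (· ∈ ω)).card} ∩ D₂))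
        + (1 - (prodBernoulli p).real {ω : Set ι | t ≤ (S.filter (· ∈ ω)).card}) *
          (prodBernoulli p).real ({ω : Set ι | s ≤ (S.filter (· ∈ ω)).card} ∩ A) *
          (prodBernoulli p).real ({ω : Set ι | s ≤ (S.filter (· ∈ ω)).card} ∩ D₂)
        - (1 - (prodBernoulli p).real {ω : Set ι | t ≤ (S.filter (· ∈ ω)).card}) * (prodBernoulli p).real {ω : Set ι | s ≤ (S.filter (· ∈ ω)).card} *
          (prodBernoulli p).real A * (prodBernoulli p).real D₂) ≤ 0 := by
    rw [← inter_ballPart_card_succ K D₂, twoLumpVar_ballPart_eq_sum_in p hKS t s hD₂K hD₂A (K.card + 1)]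
    refine sum_nonpos fun k _ => ?_
    by_cases hk : k < g₁
    · exact mul_nonpos_of_nonneg_of_nonpos measureReal_nonneg (hin k hk)
    · have : D₂ ∩ {ω : Set ι | (K.filter (· ∈ ω)).card = k} = ∅ := Set.eq_empty_of_forall_notMem fun ω h => by
        have := hlev₂ ω h.1; have h2 := h.2; simp only [Set.mem_setOf_eq] at h2; omega
      rw [this, measureReal_empty, zero_mul]
  linarith

/-- **The removal step does not increase `Ψ`**: for an increasing `K`-determined `Bs` (e.g. the hull) and the COSTLY-level signs
`0 ≤ Cin(k)` for `k ≥ g₁`, `0 ≤ Cout(k)` for `k ≥ g₂` (`g₁ ≤ g₂`): `Ψ(A, ↑(Bs ∖ G)) ≤ Ψ(A, Bs)`. [this work] -/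
theorem twoLump_lift_le (p : ι → unitInterval) (hKS : K ⊆ S) (t s : ℕ) {Bs : Set (Set ι)} (hBs : IsUpperSet Bs)
    (hAK : DeterminedBy A (↑K : Set ι)) (hBsK : DeterminedBy Bs (↑K : Set ι)) (hg : g₁ ≤ g₂)
    (hout : ∀ k, k ≤ K.card → g₂ ≤ k → 0 ≤ ((prodBernoulli p).real {ω : Set ι | s ≤ (S.filter (· ∈ ω)).card} *
            ((prodBernoulli p).real A - (prodBernoulli p).real ({ω : Set ι | t ≤ (S.filter (· ∈ ω)).card} ∩ A)) *
            (1 - (prodBernoulli p).real {ω : Set ι | t ≤ ((S \ K).filter (· ∈ ω)).card + k})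
          + (1 - (prodBernoulli p).real {ω : Set ι | t ≤ (S.filter (· ∈ ω)).card}) *
            (prodBernoulli p).real ({ω : Set ι | s ≤ (S.filter (· ∈ ω)).card} ∩ A) *
            (prodBernoulli p).real {ω : Set ι | s ≤ ((S \ K).filter (· ∈ ω)).card + k}
          - (1 - (prodBernoulli p).real {ω : Set ι | t ≤ (S.filter (· ∈ ω)).card}) * (prodBernoulli p).real {ω : Set ι | s ≤ (S.filter (· ∈ ω)).card} *
            (prodBernoulli p).real A))
    (hin : ∀ k, k ≤ K.card → g₁ ≤ k → 0 ≤ ((1 - (prodBernoulli p).real {ω : Set ι | t ≤ (S.filter (· ∈ ω)).card}) * (prodBernoulli p).real {ω : Set ι | s ≤ (S.filter (· ∈ ω)).card} *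
            ((prodBernoulli p).real {ω : Set ι | t ≤ ((S \ K).filter (· ∈ ω)).card + k}
              - (prodBernoulli p).real {ω : Set ι | s ≤ ((S \ K).filter (· ∈ ω)).card + k})
          + ((prodBernoulli p).real {ω : Set ι | s ≤ (S.filter (· ∈ ω)).card} *
              ((prodBernoulli p).real A - (prodBernoulli p).real ({ω : Set ι | t ≤ (S.filter (· ∈ ω)).card} ∩ A)) *
              (1 - (prodBernoulli p).real {ω : Set ι | t ≤ ((S \ K).filter (· ∈ ω)).card + k})
            + (1 - (prodBernoulli p).real {ω : Set ι | t ≤ (S.filter (· ∈ ω)).card}) *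
              (prodBernoulli p).real ({ω : Set ι | s ≤ (S.filter (· ∈ ω)).card} ∩ A) *
              (prodBernoulli p).real {ω : Set ι | s ≤ ((S \ K).filter (· ∈ ω)).card + k}
            - (1 - (prodBernoulli p).real {ω : Set ι | t ≤ (S.filter (· ∈ ω)).card}) *
              (prodBernoulli p).real {ω : Set ι | s ≤ (S.filter (· ∈ ω)).card} * (prodBernoulli p).real A))) :
    ((1 - (prodBernoulli p).real {ω : Set ι | t ≤ (S.filter (· ∈ ω)).card}) * (prodBernoulli p).real {ω : Set ι | s ≤ (S.filter (· ∈ ω)).card} *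
          ((prodBernoulli p).real ({ω : Set ι | t ≤ (S.filter (· ∈ ω)).card} ∩ A ∩ {ω : Set ι | ∃ ω' : Set ι, ω' ⊆ ω ∧ ω' ∈ Bs ∧ ω' ∉ (A ∩ {ω : Set ι | g₁ ≤ (K.filter (· ∈ ω)).card}) ∪ {ω : Set ι | g₂ ≤ (K.filter (· ∈ ω)).card}})
            - (prodBernoulli p).real ({ω : Set ι | s ≤ (S.filter (· ∈ ω)).card} ∩ A ∩ {ω : Set ι | ∃ ω' : Set ι, ω' ⊆ ω ∧ ω' ∈ Bs ∧ ω' ∉ (A ∩ {ω : Set ι | g₁ ≤ (K.filter (· ∈ ω)).card}) ∪ {ω : Set ι | g₂ ≤ (K.filter (· ∈ ω)).card}}))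
        + (prodBernoulli p).real {ω : Set ι | s ≤ (S.filter (· ∈ ω)).card} *
          ((prodBernoulli p).real A - (prodBernoulli p).real ({ω : Set ι | t ≤ (S.filter (· ∈ ω)).card} ∩ A)) *
          ((prodBernoulli p).real {ω : Set ι | ∃ ω' : Set ι, ω' ⊆ ω ∧ ω' ∈ Bs ∧ ω' ∉ (A ∩ {ω : Set ι | g₁ ≤ (K.filter (· ∈ ω)).card}) ∪ {ω : Set ι | g₂ ≤ (K.filter (· ∈ ω)).card}} - (prodBernoulli p).real ({ω : Set ι | t ≤ (S.filter (· ∈ ω)).card} ∩ {ω : Set ι | ∃ ω' : Set ι, ω' ⊆ ω ∧ ω' ∈ Bs ∧ ω' ∉ (A ∩ {ω : Set ι | g₁ ≤ (K.filter (· ∈ ω)).card}) ∪ {ω : Set ι | g₂ ≤ (K.filter (· ∈ ω)).card}}))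
        + (1 - (prodBernoulli p).real {ω : Set ι | t ≤ (S.filter (· ∈ ω)).card}) *
          (prodBernoulli p).real ({ω : Set ι | s ≤ (S.filter (· ∈ ω)).card} ∩ A) *
          (prodBernoulli p).real ({ω : Set ι | s ≤ (S.filter (· ∈ ω)).card} ∩ {ω : Set ι | ∃ ω' : Set ι, ω' ⊆ ω ∧ ω' ∈ Bs ∧ ω' ∉ (A ∩ {ω : Set ι | g₁ ≤ (K.filter (· ∈ ω)).card}) ∪ {ω : Set ι | g₂ ≤ (K.filter (· ∈ ω)).card}})
        - (1 - (prodBernoulli p).real {ω : Set ι | t ≤ (S.filter (· ∈ ω)).card}) * (prodBernoulli p).real {ω : Set ι | s ≤ (S.filter (· ∈ ω)).card} *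
          (prodBernoulli p).real A * (prodBernoulli p).real {ω : Set ι | ∃ ω' : Set ι, ω' ⊆ ω ∧ ω' ∈ Bs ∧ ω' ∉ (A ∩ {ω : Set ι | g₁ ≤ (K.filter (· ∈ ω)).card}) ∪ {ω : Set ι | g₂ ≤ (K.filter (· ∈ ω)).card}})
      ≤ ((1 - (prodBernoulli p).real {ω : Set ι | t ≤ (S.filter (· ∈ ω)).card}) * (prodBernoulli p).real {ω : Set ι | s ≤ (S.filter (· ∈ ω)).card} *
          ((prodBernoulli p).real ({ω : Set ι | t ≤ (S.filter (· ∈ ω)).card} ∩ A ∩ Bs)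
            - (prodBernoulli p).real ({ω : Set ι | s ≤ (S.filter (· ∈ ω)).card} ∩ A ∩ Bs))
        + (prodBernoulli p).real {ω : Set ι | s ≤ (S.filter (· ∈ ω)).card} *
          ((prodBernoulli p).real A - (prodBernoulli p).real ({ω : Set ι | t ≤ (S.filter (· ∈ ω)).card} ∩ A)) *
          ((prodBernoulli p).real Bs - (prodBernoulli p).real ({ω : Set ι | t ≤ (S.filter (· ∈ ω)).card} ∩ Bs))
        + (1 - (prodBernoulli p).real {ω : Set ι | t ≤ (S.filter (· ∈ ω)).card}) *
          (prodBernoulli p).real ({ω : Set ι | s ≤ (S.filter (· ∈ ω)).card} ∩ A) *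
          (prodBernoulli p).real ({ω : Set ι | s ≤ (S.filter (· ∈ ω)).card} ∩ Bs)
        - (1 - (prodBernoulli p).real {ω : Set ι | t ≤ (S.filter (· ∈ ω)).card}) * (prodBernoulli p).real {ω : Set ι | s ≤ (S.filter (· ∈ ω)).card} *
          (prodBernoulli p).real A * (prodBernoulli p).real Bs) := by
  set G : Set (Set ι) := (A ∩ {ω : Set ι | g₁ ≤ (K.filter (· ∈ ω)).card}) ∪ {ω : Set ι | g₂ ≤ (K.filter (· ∈ ω)).card} with hGdef
  set B₂ : Set (Set ι) := {ω : Set ι | ∃ ω' : Set ι, ω' ⊆ ω ∧ ω' ∈ Bs ∧ ω' ∉ G} with hB₂def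
  set D₁ : Set (Set ι) := (Bs \ B₂) \ A with hD₁
  set D₂ : Set (Set ι) := (Bs \ B₂) ∩ A with hD₂
  have hB₂Bs : B₂ ⊆ Bs := lift_subset hBs
  have hdec : Bs = (B₂ ∪ D₁) ∪ D₂ := by
    ext ω
    simp only [hD₁, hD₂, Set.mem_union, Set.mem_sdiff, Set.mem_inter_iff]
    constructor
    · intro h
      by_cases hb : ω ∈ B₂
      · exact Or.inl (Or.inl hb)
      · by_cases ha : ω ∈ A
        · exact Or.inr ⟨⟨h, hb⟩, ha⟩
        · exact Or.inl (Or.inr ⟨⟨h, hb⟩, ha⟩)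
    · rintro ((hb | ⟨⟨h, _⟩, _⟩) | ⟨⟨h, _⟩, _⟩)
      · exact hB₂Bs hb
      · exact h
      · exact h
  have hdisj1 : Disjoint B₂ D₁ := Set.disjoint_left.2 fun ω hb hd => hd.1.2 hb
  have hdisj2 : Disjoint (B₂ ∪ D₁) D₂ := Set.disjoint_left.2 fun ω h hd => by
    rcases h with hb | hd1
    · exact hd.1.2 hb
    · exact hd1.2 hd.2
  have hD₁A : Disjoint D₁ A := Set.disjoint_left.2 fun ω hd ha => hd.2 ha
  have hD₂A : D₂ ⊆ A := fun ω h => h.2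
  have hGK : DeterminedBy G (↑K : Set ι) := determinedBy_costly2 hAK g₁ g₂
  have hB₂K : DeterminedBy B₂ (↑K : Set ι) := determinedBy_lift hBsK hGK
  have hD₁K : DeterminedBy D₁ (↑K : Set ι) := determinedBy_sdiff' (determinedBy_sdiff' hBsK hB₂K) hAK
  have hD₂K : DeterminedBy D₂ (↑K : Set ι) := (determinedBy_sdiff' hBsK hB₂K).inter hAK
  -- levels: points of `Bs \ B₂` are inside `G`
  have hlev₁ : ∀ ω ∈ D₁, g₂ ≤ (K.filter (· ∈ ω)).card := by
    intro ω hω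
    rcases sdiff_lift_subset Bs G hω.1 with ⟨ha, _⟩ | h
    · exact absurd ha hω.2
    · exact h
  have hlev₂ : ∀ ω ∈ D₂, g₁ ≤ (K.filter (· ∈ ω)).card := by
    intro ω hω
    rcases sdiff_lift_subset Bs G hω.1 with ⟨_, h⟩ | h
    · exact h
    · simp only [Set.mem_setOf_eq] at h ⊢; omega
  rw [hdec, twoLumpVar_union p _ _ A _ _ hdisj2, twoLumpVar_union p _ _ A _ _ hdisj1]
  have hv₁ : 0 ≤ ((1 - (prodBernoulli p).real {ω : Set ι | t ≤ (S.filter (· ∈ ω)).card}) * (prodBernoulli p).real {ω : Set ι | s ≤ (S.filter (· ∈ ω)).card} *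
          ((prodBernoulli p).real ({ω : Set ι | t ≤ (S.filter (· ∈ ω)).card} ∩ A ∩ D₁)
            - (prodBernoulli p).real ({ω : Set ι | s ≤ (S.filter (· ∈ ω)).card} ∩ A ∩ D₁))
        + (prodBernoulli p).real {ω : Set ι | s ≤ (S.filter (· ∈ ω)).card} *
          ((prodBernoulli p).real A - (prodBernoulli p).real ({ω : Set ι | t ≤ (S.filter (· ∈ ω)).card} ∩ A)) *
          ((prodBernoulli p).real D₁ - (prodBernoulli p).real ({ω : Set ι | t ≤ (S.filter (· ∈ ω)).card} ∩ D₁))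
        + (1 - (prodBernoulli p).real {ω : Set ι | t ≤ (S.filter (· ∈ ω)).card}) *
          (prodBernoulli p).real ({ω : Set ι | s ≤ (S.filter (· ∈ ω)).card} ∩ A) *
          (prodBernoulli p).real ({ω : Set ι | s ≤ (S.filter (· ∈ ω)).card} ∩ D₁)
        - (1 - (prodBernoulli p).real {ω : Set ι | t ≤ (S.filter (· ∈ ω)).card}) * (prodBernoulli p).real {ω : Set ι | s ≤ (S.filter (· ∈ ω)).card} *
          (prodBernoulli p).real A * (prodBernoulli p).real D₁) := by
    rw [← inter_ballPart_card_succ K D₁, twoLumpVar_ballPart_eq_sum_out p hKS t s hD₁K hD₁A (K.card + 1)]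
    refine sum_nonneg fun k hk' => ?_
    have hkK : k ≤ K.card := by have := Finset.mem_range.1 hk'; omega
    by_cases hk : g₂ ≤ k
    · exact mul_nonneg measureReal_nonneg (hout k hkK hk)
    · have : D₁ ∩ {ω : Set ι | (K.filter (· ∈ ω)).card = k} = ∅ := Set.eq_empty_of_forall_notMem fun ω h => by
        have := hlev₁ ω h.1; have h2 := h.2; simp only [Set.mem_setOf_eq] at h2; omega
      rw [this, measureReal_empty, zero_mul]
  have hv₂ : 0 ≤ ((1 - (prodBernoulli p).real {ω : Set ι | t ≤ (S.filter (· ∈ ω)).card}) * (prodBernoulli p).real {ω : Set ι | s ≤ (S.filter (· ∈ ω)).card} *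
          ((prodBernoulli p).real ({ω : Set ι | t ≤ (S.filter (· ∈ ω)).card} ∩ A ∩ D₂)
            - (prodBernoulli p).real ({ω : Set ι | s ≤ (S.filter (· ∈ ω)).card} ∩ A ∩ D₂))
        + (prodBernoulli p).real {ω : Set ι | s ≤ (S.filter (· ∈ ω)).card} *
          ((prodBernoulli p).real A - (prodBernoulli p).real ({ω : Set ι | t ≤ (S.filter (· ∈ ω)).card} ∩ A)) *
          ((prodBernoulli p).real D₂ - (prodBernoulli p).real ({ω : Set ι | t ≤ (S.filter (· ∈ ω)).card} ∩ D₂))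
        + (1 - (prodBernoulli p).real {ω : Set ι | t ≤ (S.filter (· ∈ ω)).card}) *
          (prodBernoulli p).real ({ω : Set ι | s ≤ (S.filter (· ∈ ω)).card} ∩ A) *
          (prodBernoulli p).real ({ω : Set ι | s ≤ (S.filter (· ∈ ω)).card} ∩ D₂)
        - (1 - (prodBernoulli p).real {ω : Set ι | t ≤ (S.filter (· ∈ ω)).card}) * (prodBernoulli p).real {ω : Set ι | s ≤ (S.filter (· ∈ ω)).card} *
          (prodBernoulli p).real A * (prodBernoulli p).real D₂) := by
    rw [← inter_ballPart_card_succ K D₂, twoLumpVar_ballPart_eq_sum_in p hKS t s hD₂K hD₂A (K.card + 1)]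
    refine sum_nonneg fun k hk' => ?_
    have hkK : k ≤ K.card := by have := Finset.mem_range.1 hk'; omega
    by_cases hk : g₁ ≤ k
    · exact mul_nonneg measureReal_nonneg (hin k hkK hk)
    · have : D₂ ∩ {ω : Set ι | (K.filter (· ∈ ω)).card = k} = ∅ := Set.eq_empty_of_forall_notMem fun ω h => by
        have := hlev₂ ω h.1; have h2 := h.2; simp only [Set.mem_setOf_eq] at h2; omega
      rw [this, measureReal_empty, zero_mul]
  linarith

end reduct

/-! ## §5 The removal is pivot-free (no exempt coordinate) -/

section free

variable {F : Finset ι} {e : ι} {B : Set (Set ι)}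

/-- **The reduced partner is pivot-free** for an abstract costly region, without an exempt coordinate (from `lift_free_region` when the
constant block `F` is nonempty; direct when `F = ∅`). [this work] -/
theorem lift_free_region' (heF : e ∉ F) {G : Set (Set ι)} (hGup : IsUpperSet G)
    (hGK : DeterminedBy G (↑(insert e F) : Set ι)) (hBK : DeterminedBy B (↑(insert e F) : Set ι))
    (hGdom : ∀ j ∈ F, ∀ ω ∈ G, e ∉ ω → j ∈ ω → (ω \ {j}) ∪ {e} ∈ G)
    (hdomB : ∀ j ∈ F, ∀ ω ∈ B, e ∈ ω → j ∉ ω → (ω \ {e}) ∪ {j} ∈ B) :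
    ∀ ω : Set ι, e ∉ ω →
      insert e ω ∈ {ω : Set ι | ∃ ω' : Set ι, ω' ⊆ ω ∧
          ω' ∈ {ω : Set ι | ∀ ω'' : Set ι, ω ⊆ ω'' → ω'' ∈ G → ω'' ∈ B} ∧ ω' ∉ G} →
      ω ∈ {ω : Set ι | ∃ ω' : Set ι, ω' ⊆ ω ∧
          ω' ∈ {ω : Set ι | ∀ ω'' : Set ι, ω ⊆ ω'' → ω'' ∈ G → ω'' ∈ B} ∧ ω' ∉ G} := by
  rcases F.eq_empty_or_nonempty with hF | ⟨o, hoF⟩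
  swap
  · exact lift_free_region heF hoF hGup hGK hBK hGdom (fun j hj _ => hdomB j hj)
  -- `F = ∅`: everything is `{e}`-determined
  subst hF
  intro ω heω hins
  set Bs : Set (Set ι) := {ω : Set ι | ∀ ω'' : Set ι, ω ⊆ ω'' → ω'' ∈ G → ω'' ∈ B} with hBsdef
  have hBsup : IsUpperSet Bs := isUpperSet_hgen G B
  obtain ⟨ω', hsub, hBs', hG'⟩ := hins
  by_contra hω
  have heω' : e ∈ ω' := by
    by_contra h
    refine hω ⟨ω', fun x hx => ?_, hBs', hG'⟩
    rcases (Set.mem_insert_iff.1 (hsub hx)) with rfl | hx'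
    · exact absurd hx h
    · exact hx'
  have hK : (↑(insert e (∅ : Finset ι)) : Set ι) = {e} := by simp
  have hagree : insert e ω ∩ (↑(insert e (∅ : Finset ι)) : Set ι) = ω' ∩ ↑(insert e (∅ : Finset ι)) := by
    rw [hK]; ext x
    simp only [Set.mem_inter_iff, Set.mem_insert_iff, Set.mem_singleton_iff]
    constructor
    · rintro ⟨_, rfl⟩; exact ⟨heω', rfl⟩
    · rintro ⟨_, rfl⟩; exact ⟨Or.inl rfl, rfl⟩
  have hinsG : insert e ω ∉ G := fun h => hG' (((determinedBy_iff _ _).1 hGK _ _ hagree).1 h)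
  have hinsBs : insert e ω ∈ Bs := ((determinedBy_iff _ _).1 (determinedBy_hgen hGK hBK) _ _ hagree).2 hBs'
  have hωG : ω ∉ G := fun h => hinsG (hGup (Set.subset_insert e ω) h)
  have hωBs : ω ∉ Bs := fun h => hω ⟨ω, subset_rfl, h, hωG⟩
  apply hωBs
  intro z hz hzG
  by_cases hez : e ∈ z
  · have hagree' : insert e ω ∩ (↑(insert e (∅ : Finset ι)) : Set ι) = z ∩ ↑(insert e (∅ : Finset ι)) := by
      rw [hK]; ext x
      simp only [Set.mem_inter_iff, Set.mem_insert_iff, Set.mem_singleton_iff]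
      constructor
      · rintro ⟨_, rfl⟩; exact ⟨hez, rfl⟩
      · rintro ⟨_, rfl⟩; exact ⟨Or.inl rfl, rfl⟩
    exact absurd (((determinedBy_iff _ _).1 hGK _ _ hagree').2 hzG) hinsG
  · have hagree' : ω ∩ (↑(insert e (∅ : Finset ι)) : Set ι) = z ∩ ↑(insert e (∅ : Finset ι)) := by
      rw [hK]; ext x
      simp only [Set.mem_inter_iff, Set.mem_singleton_iff]
      constructor
      · rintro ⟨hx, rfl⟩; exact absurd hx heω
      · rintro ⟨hx, rfl⟩; exact absurd hx hez
    exact absurd (((determinedBy_iff _ _).1 hGK _ _ hagree').2 hzG) hωG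

end free

end SahiOneStep

end Summit.CriticalPhenomena.PercolationContinuityZ3.Theorems
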